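import Literature.Analysis.FluidPDE.Axisymmetric
import HarnessLib

/-!
# Elgindi–Ghoul–Masmoudi: finite-energy `C^{1,α}` blow-up for 3D Euler
(the result *as printed*, and its reduction to `Literature.Analysis.FluidPDE.elgindi_euler_blowup`)

Topic `Literature/Analysis/FluidPDE`. Faithfulness layer for the named fact
`Literature.Analysis.FluidPDE.elgindi_euler_blowup` (`Axisymmetric.lean`, statement **ns.S29 (i)**):
the theorem *as printed* is quoted below and the elementary passage from its printed conclusion to
the reviewed rendering `elgindi_euler_blowup` is proved (`elgindi_euler_blowup_of_printedBlowup`);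
the printed theorem is **not** vendored as a second named fact (it is `elgindi_euler_blowup`
reworded — same Theorem 1 of the same paper, more conjuncts — and a decomposition child may not
restate its parent, D-0026; an earlier version of this file carried it as
`ElgindiGhoulMasmoudi2021_finiteEnergyBlowup`, merged back 2026-08-15). Sources (both held
in the literature store as `corpus-tex` renderings; "p." = chunk number of the held text,
theorem numbers are those of the arXiv versions):

* `[ElgindiGhoulMasmoudi2021]` T. M. Elgindi, T.-E. Ghoul, N. Masmoudi, *On the stability of
  self-similar blow-up for `C^{1,α}` solutions to the incompressible Euler equations on `ℝ³`*,
  Camb. J. Math. 9 (2021) 1035–1075, arXiv:1910.14071: §1.3 Theorem 1 (p. 3), Remark 1.1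
  (p. 3), §1.4 (p. 4: "`Ḡ` is axi-symmetric without swirl"), §2.1 (p. 7: the axisymmetric
  system, odd symmetry in `x₃`), §2.5 Definition 2.1, Theorem 2, Corollary 2.2 (p. 9), §2.6
  "Solutions with compactly supported vorticity and finite energy" (p. 9), §7 (p. 18: the
  differential inequality `dĒ/ds ≤ −cĒ + Cα^{-3/2}Ē^{3/2}` closing Theorem 2).
* `[Elgindi2021]` T. M. Elgindi, *Finite-time singularity formation for `C^{1,α}` solutions to
  the incompressible Euler equations on `ℝ³`*, Ann. of Math. 194 (2021), arXiv:1904.04795: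
  §1.3 Theorem 1 and Remarks 1.3 (exact self-similarity), 1.4 (infinite energy; finite energy
  deferred to the companion paper) and 1.5 (axially symmetric without swirl) (p. 4); §1.7
  (p. 7: "`f ∈ C^{1,β}` when `∇f ∈ C^β`").

## The printed statement ([ElgindiGhoulMasmoudi2021], §1.3 Theorem 1, p. 3)

"There is a continuum of `α > 0` for which there exists a divergence-free `u₀ ∈ C^{1,α}(ℝ³)`
with compactly supported initial vorticity `ω₀ ∈ C^α(ℝ³)` so that the unique local solution to
(1.1)–(1.3) belonging to the class `L² ∩ C^{1,α}_{x,t}([0,1) × ℝ³)` satisfies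
`lim_{t→1} ∫₀ᵗ |ω(s)|_{L^∞} ds = +∞`. Moreover, the blow-up is stable in a sense that is
specified in Theorem 2." Here `|f|_{C^{1,β}} = |f|_{C^β} + |∇f|_{C^β}`,
`|f|_{C^β} = sup |f| + sup_{x≠y} |f(x) − f(y)|/|x − y|^β` (§1.7, p. 5).

## Architecture of the printed proof (for the record; sizes refer to a Lean formalisation)

1. ([Elgindi2021], Thm 1 with Remarks 1.3–1.5; recalled in [ElgindiGhoulMasmoudi2021] §2.3,
   p. 7) In the variables `R = ρ^α`, `θ = arctan(x₃/r)` of the axisymmetric no-swirl Euler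
   equations with odd symmetry in `x₃`, there is for all small `α > 0` an exactly self-similar
   solution `Ω = (T−t)^{-1} F(R/(T−t)^{1+δ}, θ)`, `F = F_* + α²g`,
   `F_* = (Γ/c)·4αz/(1+z)²`, `|g|_{𝓗ᵏ} ≤ C`, `δ = δ(α)` small; its velocity is `C^{1,α}` but of
   infinite energy. Size: XL (the Annals paper: fundamental model, coercivity of the linearised
   operator in the weighted spaces `𝓗ᵏ`, elliptic estimates for the Biot–Savart law in `(R, θ)`,
   compactness/modulation argument).
2. ([ElgindiGhoulMasmoudi2021] §2.3–2.5) Dynamic rescaling `Ω = λ^{-1} W(μR/λ^{1+δ}, s, θ)`,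
   `ds/dt = λ^{-1}`, with modulation parameters `λ(s), μ(s)` fixing `L₁₂(ε)(0) = 0`;
   linearisation `W = F + ε` around the profile, coercivity of `𝓜_F` and `𝓜_F^φ` in `𝓗ᵏ`
   (§3), laws of `μ, λ` (§4), elliptic estimates (§5), energy estimate (§7):
   **Theorem 2** (p. 9): for `k ≥ 4` and `α < α₀` there are `δ₀, κ > 0` such that data with
   `𝓔(ε₀, 𝒰₀^φ) < δ₀ α^{3/2}`, `L₁₂(ε₀)(0) = 0` launch a unique global solution of the modulated
   system with `|μ_s| + |λ_s/λ + 1| + 𝓔(s) ≤ C 𝓔₀ e^{−κs}`; **Corollary 2.2**: `μ(s) → μ_∞`,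
   `λ(s)eˢ → 1/T_*`, `T_* ≈ 1`. Size: XL (≈ 40 pp. of weighted energy estimates on top of 1).
3. (§2.6, p. 9) Compactly supported data in the stability class:
   `ε₀^{M,β} = (χ(z/M) − 1)F + β sin(2θ) χ((z−3)²)`, `β = −a_M/b`, `M = α^{-8}`, so that
   `F + ε₀` is compactly supported, `L₁₂(ε₀)(0) = 0` and `‖ε₀‖_{𝓗ᵏ} ≤ Cα²`; the swirl datum
   `𝒰₀^φ` is "taken compactly supported" — zero is allowed, and then the solution has no swirl
   for all times (the swirl equation (2.1) is linear homogeneous in `u^φ`; uniqueness in Thm 2).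
   Compactly supported vorticity gives a finite-energy velocity. Size: M given 1–2.
4. (classical background, not printed) The dictionary between solutions of the modulated system
   and classical solutions `(u, p)` of 3D Euler in physical variables (axisymmetric Biot–Savart
   law, `𝓗ᵏ ↪ L^∞`, `C^α` vorticity ⟺ `C^{1,α}` velocity), local well-posedness and uniqueness in
   `L² ∩ C^{1,α}` (Lichtenstein, Gunther; [Elgindi2021] §1.2) and the Beale–Kato–Majda criterion;
   the physical blow-up time is `t(∞) = ∫₀^∞ λ ds = T_*`, normalised to `1` by the Euler scaling
   `u ↦ T_* u(T_* t, x)`. Size: L–XL (no Biot–Savart / singular integrals in Mathlib).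

Only the final, elementary step is proved in this file: from the printed conclusion (`C^{1,α}`
bounds on compact sub-intervals of `[0, 1)` and `lim_{t→1} ∫₀ᵗ ‖ω‖_∞ = ∞`) to the `limsup` form
`Fluid.VorticityBlowsUpAt u 1` of the reviewed paraphrase `elgindi_euler_blowup`.

## What this file proves

* the general lemmas `norm_curl_le_four_mul` (`|ω| ≤ 4‖∇u‖`),
  `eSupNorm_curl_le_of_eContDiffHolderNorm_le` (`‖ω‖_∞ ≤ 4‖u‖_{C^{1,α}}`),
  `lintegral_Ioo_eq_top_of_tendsto` (the printed `lim_{t→T} ∫₀ᵗ = ∞` gives `∫_{(0,T)} = ∞`) and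
  `vorticityBlowsUpAt_of_lintegral_eSupNorm_curl` (Beale–Kato–Majda integral form + local bounds
  ⟹ the `limsup` form `VorticityBlowsUpAt u T`), used throughout the Elgindi and Navier–Stokes
  BKM files;
* `elgindi_euler_blowup_of_printedBlowup`: `elgindi_euler_blowup` from (the solution half of) the
  printed conclusion of Theorem 1 in the velocity–pressure rendering already reviewed for
  `elgindi_euler_blowup` — a classical solution `Fluid.IsClassicalEulerOnDomain (Ico 0 1) ⊤ 0 0 u p`
  on the whole space whose slices are `C^{1,α}`, of finite energy, axisymmetric and swirl-free,
  with the class `C^{1,α}_{x,t}` on compact sub-intervals rendered as **locally uniform `C^{1,α}`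
  bounds** `sup_{t ≤ T} ‖u(t)‖_{C^{1,α}} < ∞` (`T < 1`), and blow-up in the printed
  **Beale–Kato–Majda form** `lim_{t→1} ∫₀ᵗ ‖ω(s)‖_∞ ds = +∞`. The datum clauses of the printed
  theorem (`u₀ ∈ C^{1,α}`, divergence free, compactly supported vorticity) are not needed for
  `elgindi_euler_blowup` and are carried by the downstream facts that produce the solution
  (`ElgindiBlowupContinuation.lean`, `ElgindiAprioriBlowupProofs.lean`, where the same reduction
  at the un-normalised blow-up time `T_*` is `elgindi_euler_blowup_of_bkmBlowupAt`).

## Faithfulness notes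

* `‖ω(s)‖_{L^∞}` is the extended sup norm `Literature.Analysis.FunctionSpaces.eSupNorm (curl (u s))`
  (`[0, ∞]`-valued, no junk) and `∫₀ᵗ` the lower Lebesgue integral over `(0, t)`; the printed
  `lim_{t→1} ∫₀ᵗ ‖ω‖_∞ = +∞` is `Tendsto (t ↦ ∫_{(0,t)} ‖ω‖_∞) (𝓝[<] 1) (𝓝 ∞)` verbatim.
* In `elgindi_euler_blowup` "a continuum of `α`" is weakened to `∃ α > 0`; "unique" (uniqueness
  in `L² ∩ C^{1,α}`, a classical fact) and "stable" (Theorem 2) are not rendered; the hypotheses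
  of `elgindi_euler_blowup_of_printedBlowup` drop the time-Hölder part of `C^{1,α}_{x,t}` (only
  `sup_t ‖u(t)‖_{C^{1,α}_x}` on `[0, T]`, `T < 1`, is used) and the odd symmetry in `x₃` of the
  construction. Each omission either weakens the existential statement `elgindi_euler_blowup`
  or drops an assumption of a proved lemma, so nothing stronger than the source is asserted.
* Axisymmetry without swirl and finite energy are properties of the construction (items 1, 3
  above; [Elgindi2021] Remark 1.5; [ElgindiGhoulMasmoudi2021] p. 4 and §2.6) rather than a
  sentence of Theorem 1 — the reading already reviewed for `elgindi_euler_blowup`. The `C¹`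
  pressure is the usual classical-solution gloss (`p` = Riesz transforms of `u ⊗ u`), also as in
  `elgindi_euler_blowup`.

Mathlib has no Euler/blow-up notions (`lean search 'Elgindi|VorticityBlowsUp|BKM'`: only the
`Literature` files imported here). Used from Mathlib: `PiLp.norm_apply_le`, `PiLp.norm_single`,
`EuclideanSpace.norm_eq`, `norm_iteratedFDeriv_one`, `mem_nhdsLT_iff_exists_Ioo_subset`,
`setLIntegral_mono'`, `setLIntegral_const`, `Real.volume_Ioo`, `ge_of_tendsto`.
-/

noncomputable section

open MeasureTheory Set Function Filter TopologicalSpace WithLp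
open _root_.Topology
open scoped ContDiff NNReal ENNReal InnerProductSpace RealInnerProductSpace

namespace Literature.Analysis.FluidPDE

/-- Local notation for physical space `ℝ³ = EuclideanSpace ℝ (Fin 3)`. -/
local notation "ℝ³" => EuclideanSpace ℝ (Fin 3)

/-! ### Pointwise control of the vorticity by the velocity gradient -/

/-- Each entry `∂ⱼvᵢ(x) = Dv(x) eⱼ · eᵢ` of the Jacobian is bounded by its operator norm. [folklore] -/
theorem abs_fderiv_single_apply_le (v : ℝ³ → ℝ³) (x : ℝ³) (j i : Fin 3) :
    |fderiv ℝ v x (EuclideanSpace.single j 1) i| ≤ ‖fderiv ℝ v x‖ := by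
  have h1 : |fderiv ℝ v x (EuclideanSpace.single j 1) i| ≤
      ‖fderiv ℝ v x (EuclideanSpace.single j 1)‖ := by
    rw [← Real.norm_eq_abs]
    exact PiLp.norm_apply_le _ i
  refine h1.trans ?_
  calc ‖fderiv ℝ v x (EuclideanSpace.single j 1)‖
      ≤ ‖fderiv ℝ v x‖ * ‖EuclideanSpace.single j (1 : ℝ)‖ := ContinuousLinearMap.le_opNorm _ _
    _ = ‖fderiv ℝ v x‖ := by rw [EuclideanSpace.single, PiLp.norm_single, norm_one, mul_one]

/-- Each component of the curl is a difference of two Jacobian entries (Majda–Bertozzi, (1.11)),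
hence bounded by `2 ‖Dv(x)‖`. [folklore] -/
theorem abs_curl_apply_le (v : ℝ³ → ℝ³) (x : ℝ³) (i : Fin 3) :
    |curl v x i| ≤ 2 * ‖fderiv ℝ v x‖ := by
  have hD := abs_fderiv_single_apply_le v x
  have key : ∀ j k : Fin 3,
      |fderiv ℝ v x (EuclideanSpace.single j 1) k - fderiv ℝ v x (EuclideanSpace.single k 1) j| ≤
        2 * ‖fderiv ℝ v x‖ := fun j k =>
    (abs_sub _ _).trans (by linarith [hD j k, hD k j])
  fin_cases i
  · simpa [curl] using key 1 2
  · simpa [curl] using key 2 0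
  · simpa [curl] using key 0 1

/-- Crude pointwise control of the vorticity by the velocity gradient, `|ω(x)| ≤ 4 ‖∇u(x)‖`
(the proof gives `2√3`; any dimensional constant would do below). [folklore] -/
theorem norm_curl_le_four_mul (v : ℝ³ → ℝ³) (x : ℝ³) : ‖curl v x‖ ≤ 4 * ‖fderiv ℝ v x‖ := by
  set A := ‖fderiv ℝ v x‖ with hA
  have hA0 : 0 ≤ A := norm_nonneg _
  have hc : ∀ i : Fin 3, ‖curl v x i‖ ^ 2 ≤ (2 * A) ^ 2 := fun i => by
    rw [Real.norm_eq_abs]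
    exact pow_le_pow_left₀ (abs_nonneg _) (abs_curl_apply_le v x i) 2
  rw [EuclideanSpace.norm_eq, Real.sqrt_le_iff]
  refine ⟨by positivity, ?_⟩
  calc ∑ i, ‖curl v x i‖ ^ 2 ≤ ∑ _i : Fin 3, (2 * A) ^ 2 := Finset.sum_le_sum fun i _ => hc i
    _ = 3 * (2 * A) ^ 2 := by simp
    _ ≤ (4 * A) ^ 2 := by nlinarith

/-- A single derivative sup norm is dominated by the `C^{k,r}` norm:
`‖Dʲ f‖_∞ ≤ ‖f‖_{C^{k,r}}` for `j ≤ k` (Gilbarg–Trudinger §4.1, (4.4)). [folklore] -/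
theorem eSupNorm_iteratedFDeriv_le_eContDiffHolderNorm {E' Y : Type*} [NormedAddCommGroup E']
    [NormedSpace ℝ E'] [NormedAddCommGroup Y] [NormedSpace ℝ Y] {j k : ℕ} (hj : j ≤ k) (r : ℝ≥0)
    (f : E' → Y) :
    FunctionSpaces.eSupNorm (iteratedFDeriv ℝ j f) ≤ FunctionSpaces.eContDiffHolderNorm k r f := by
  unfold FunctionSpaces.eContDiffHolderNorm
  refine le_trans ?_ le_self_add
  exact Finset.single_le_sum (f := fun j => FunctionSpaces.eSupNorm (iteratedFDeriv ℝ j f))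
    (fun _ _ => zero_le) (Finset.mem_range.2 (Nat.lt_succ_of_le hj))

/-- For a field with `‖v‖_{C^{1,α}} ≤ C` the vorticity is bounded by `4C`:
`‖ω‖_∞ ≤ 4 ‖∇v‖_∞ ≤ 4 ‖v‖_{C^{1,α}}`. [folklore] -/
theorem eSupNorm_curl_le_of_eContDiffHolderNorm_le {α : ℝ≥0} {v : ℝ³ → ℝ³} {C : ℝ≥0∞}
    (hC : FunctionSpaces.eContDiffHolderNorm 1 α v ≤ C) :
    FunctionSpaces.eSupNorm (curl v) ≤ 4 * C := by
  refine iSup_le fun x => ?_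
  have h1 : ‖fderiv ℝ v x‖ₑ ≤ C := by
    have := FunctionSpaces.enorm_le_eSupNorm (iteratedFDeriv ℝ 1 v) x
    rw [← ofReal_norm, norm_iteratedFDeriv_one, ofReal_norm] at this
    exact this.trans ((eSupNorm_iteratedFDeriv_le_eContDiffHolderNorm le_rfl α v).trans hC)
  calc ‖curl v x‖ₑ ≤ ENNReal.ofReal (4 * ‖fderiv ℝ v x‖) := by
        rw [← ofReal_norm]
        exact ENNReal.ofReal_le_ofReal (norm_curl_le_four_mul v x)
    _ = 4 * ‖fderiv ℝ v x‖ₑ := by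
        rw [ENNReal.ofReal_mul (by norm_num), ← ofReal_norm, ENNReal.ofReal_ofNat]
    _ ≤ 4 * C := by gcongr

/-! ### The Beale–Kato–Majda integral form of blow-up implies the `limsup` form -/

/-- **The printed form of blow-up gives divergence of the full integral.** For a `[0, ∞]`-valued
integrand, `lim_{t ↑ T} ∫_{(0,t)} f = ∞` forces `∫_{(0,T)} f = ∞`, since `∫_{(0,t)} f ≤ ∫_{(0,T)} f`
for `t < T` (the converse is monotone convergence and is not needed here). This turns the
printed `lim_{t→1} ∫₀ᵗ |ω(s)|_{L^∞} ds = +∞` ([ElgindiGhoulMasmoudi2021] Thm 1; [Elgindi2021]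
Thm 1) into the hypothesis of `vorticityBlowsUpAt_of_lintegral_eSupNorm_curl`. [folklore] -/
theorem lintegral_Ioo_eq_top_of_tendsto {f : ℝ → ℝ≥0∞} {T : ℝ}
    (h : Tendsto (fun t => ∫⁻ s in Ioo 0 t, f s) (𝓝[<] T) (𝓝 ∞)) :
    ∫⁻ s in Ioo 0 T, f s = (∞ : ℝ≥0∞) := by
  refine top_le_iff.1 (le_of_tendsto h ?_)
  filter_upwards [self_mem_nhdsWithin] with t ht
  exact lintegral_mono_set (Ioo_subset_Ioo_right (le_of_lt ht))

/-- **From `∫₀ᵀ ‖ω(s)‖_∞ ds = ∞` to `limsup_{t ↑ T} ‖ω(t)‖_∞ = ∞`.** If the vorticity of `u` is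
bounded on `[0, T'] × ℝ³` for every `T' < T` (as it is for a solution which is `C^{1,α}` on
compact sub-intervals of `[0, T)`) and `∫_{(0,T)} ‖ω(s)‖_{L^∞} ds = ∞` (the Beale–Kato–Majda form
in which [Elgindi2021] and [ElgindiGhoulMasmoudi2021] state blow-up), then `‖ω(t)‖_∞` is
unbounded as `t ↑ T`, i.e. `Fluid.VorticityBlowsUpAt u T`. Proof: otherwise `‖ω‖ ≤ M` on
`(T', T) × ℝ³` for some `T' < T` and `‖ω‖ ≤ C` on `[0, T'] × ℝ³`, so the integral is at most
`(C + M)·T < ∞` (Majda–Bertozzi, Thm 3.6: the BKM criterion and its `sup` reading (3.72)). [folklore] -/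
theorem vorticityBlowsUpAt_of_lintegral_eSupNorm_curl {u : ℝ → ℝ³ → ℝ³} {T : ℝ}
    (hbd : ∀ T' < T, ∃ C : ℝ≥0∞, C < (∞ : ℝ≥0∞) ∧
      ∀ t ∈ Icc 0 T', FunctionSpaces.eSupNorm (curl (u t)) ≤ C)
    (hint : ∫⁻ s in Ioo 0 T, FunctionSpaces.eSupNorm (curl (u s)) = (∞ : ℝ≥0∞)) :
    VorticityBlowsUpAt u T := by
  by_contra hcon
  simp only [VorticityBlowsUpAt, not_forall, not_frequently, not_exists, not_lt] at hcon
  obtain ⟨M, hM⟩ := hcon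
  obtain ⟨T', hT'T, hsub⟩ := mem_nhdsLT_iff_exists_Ioo_subset.1 hM
  obtain ⟨C, hCtop, hC⟩ := hbd T' hT'T
  have hK : ∀ s ∈ Ioo 0 T, FunctionSpaces.eSupNorm (curl (u s)) ≤ C + ENNReal.ofReal M := by
    intro s hs
    rcases le_or_gt s T' with hsT' | hT's
    · exact (hC s ⟨hs.1.le, hsT'⟩).trans le_self_add
    · have hx : ∀ x, ‖curl (u s) x‖ ≤ M := hsub ⟨hT's, hs.2⟩
      refine le_trans (iSup_le fun x => ?_) le_add_self
      rw [← ofReal_norm]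
      exact ENNReal.ofReal_le_ofReal (hx x)
  have hle : ∫⁻ s in Ioo 0 T, FunctionSpaces.eSupNorm (curl (u s)) ≤
      (C + ENNReal.ofReal M) * volume (Ioo (0 : ℝ) T) :=
    (setLIntegral_mono' measurableSet_Ioo hK).trans_eq (setLIntegral_const _ _)
  have hfin : (C + ENNReal.ofReal M) * volume (Ioo (0 : ℝ) T) < (∞ : ℝ≥0∞) := by
    rw [Real.volume_Ioo]
    exact ENNReal.mul_lt_top (ENNReal.add_lt_top.2 ⟨hCtop, ENNReal.ofReal_lt_top⟩)
      ENNReal.ofReal_lt_top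
  rw [hint] at hle
  exact absurd (hle.trans_lt hfin) (lt_irrefl _)

/-! ### The theorem as printed, and the reduction -/

/-- **`elgindi_euler_blowup` from the printed form of the Elgindi–Ghoul–Masmoudi theorem.**
Camb. J. Math. 9 (2021), §1.3 **Theorem 1** (p. 3 of the held text of arXiv:1910.14071): "There
is a continuum of `α > 0` for which there exists a divergence-free `u₀ ∈ C^{1,α}(ℝ³)` with
compactly supported initial vorticity `ω₀ ∈ C^α(ℝ³)` so that the unique local solution to
(1.1)–(1.3) belonging to the class `L² ∩ C^{1,α}_{x,t}([0,1) × ℝ³)` satisfies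
`lim_{t→1} ∫₀ᵗ |ω(s)|_{L^∞} ds = +∞`. Moreover, the blow-up is stable in a sense that is specified
in Theorem 2" — obtained (§2.6, p. 9) by perturbing, inside the stability theorem §2.5 Thm 2 /
Cor 2.2, the exactly self-similar, axisymmetric, swirl-free, infinite-energy `C^{1,α}` blow-up
profile of Elgindi, Ann. of Math. 194 (2021), §1.3 Thm 1 with Remarks 1.3–1.5, into data with
compactly supported vorticity, the swirl datum `𝒰₀^φ` being allowed to vanish ("We take `𝒰₀^φ` to
be compactly supported"), so that the solution is axisymmetric without swirl and of finite energy
(the reading reviewed for `elgindi_euler_blowup`). **The reduction.** If `(u, p)` is a classical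
solution of the incompressible Euler equations (`f = 0`) on `ℝ³ × [0, 1)` whose slices `u(t)`,
`t < 1`, are `C^{1,α}` (`α > 0`) with finite energy, axisymmetric and swirl-free, whose `C^{1,α}`
norms are bounded on every `[0, T]`, `T < 1` (the printed class `C^{1,α}_{x,t}` on compact
sub-intervals, minus its time-Hölder part), and whose vorticity blows up at `t = 1` in the printed
Beale–Kato–Majda form `lim_{t ↑ 1} ∫_{(0,t)} ‖ω(s)‖_{L^∞} ds = +∞`, then `elgindi_euler_blowup`
holds: `‖ω(t)‖_∞ ≤ 4‖u(t)‖_{C^{1,α}}` on `[0, T]` (`eSupNorm_curl_le_of_eContDiffHolderNorm_le`),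
so the divergence of the integral (`lintegral_Ioo_eq_top_of_tendsto`) forces
`limsup_{t ↑ 1} ‖ω(t)‖_∞ = ∞` (`vorticityBlowsUpAt_of_lintegral_eSupNorm_curl`). The same
reduction at an arbitrary blow-up time `T > 0` (the `T_*` of Cor. 2.2, normalised to `1` by the
Euler scaling) is `elgindi_euler_blowup_of_bkmBlowupAt` (`ElgindiBlowupContinuation.lean`). The
printed theorem itself is `elgindi_euler_blowup` reworded and is deliberately not a separate
named fact (D-0026). [cite: ElgindiGhoulMasmoudi2021, §1.3 Thm 1 (p. 3); §2.5 Thm 2 and Cor 2.2, §2.6 (p. 9); Remark 1.1 (p. 3)]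
[cite: Elgindi2021, §1.3 Thm 1 and Remarks 1.3–1.5 (p. 4 of arXiv:1904.04795)] -/
theorem elgindi_euler_blowup_of_printedBlowup {α : ℝ≥0} (hα : 0 < α) {u : ℝ → ℝ³ → ℝ³}
    {p : ℝ → ℝ³ → ℝ} (hsol : FluidPDE.IsClassicalEulerOnDomain (Ico 0 1) (⊤ : Opens ℝ³) 0 0 u p)
    (hslice : ∀ t ∈ Ico (0 : ℝ) 1, FluidPDE.MemC1Holder α (u t) ∧ FluidPDE.HasFiniteEnergy (u t) ∧
      FluidPDE.IsAxisymmetric (u t) ∧ FluidPDE.HasNoSwirl (u t))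
    (hunif : ∀ T < (1 : ℝ), ∃ C : ℝ≥0, ∀ t ∈ Icc 0 T,
      FunctionSpaces.eContDiffHolderNorm 1 α (u t) ≤ C)
    (hblow : Tendsto (fun t : ℝ => ∫⁻ s in Ioo 0 t, FunctionSpaces.eSupNorm (curl (u s)))
      (𝓝[<] 1) (𝓝 ∞)) :
    elgindi_euler_blowup := by
  refine ⟨α, hα, u, p, hsol, hslice, ?_⟩
  refine vorticityBlowsUpAt_of_lintegral_eSupNorm_curl (fun T' hT' => ?_)
    (lintegral_Ioo_eq_top_of_tendsto hblow)
  obtain ⟨C, hC⟩ := hunif T' hT'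
  exact ⟨4 * C, ENNReal.mul_lt_top (by simp) ENNReal.coe_lt_top, fun t ht =>
    eSupNorm_curl_le_of_eContDiffHolderNorm_le (hC t ht)⟩

end Literature.Analysis.FluidPDE
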